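import Summits.AtomisticToContinuum.Crystallization.Theorems.LayeredLawsSelectHcp.Negative.IdealStackings
import Summits.AtomisticToContinuum.Crystallization.Theorems.LayeredLawsSelectHcp.Negative.HexCubic

/-!
# Negative knowledge for crux `LayeredLawsSelectHcp` (stmt-AtomisticToContinuum-9226), XII:
# hcp's shells are exact anticuboctahedra — the intended model satisfies H4's shell clause

Part XII (`--supports stmt-AtomisticToContinuum-9226`). `hcpInt_rel` (the twelve-entry table `q ↦ (i,j,Λ,K)`,
checked by `decide`, giving the integer relations of the master formula for every `q ∈ hcpInt`),
`hexIso_hcpPattern` (`M` maps each point of `hcpKissingPattern` to a tabulated `A`-site offset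
`i u + j v + Λ w + K n`), `shellWindow_eq_touching` (the crux's window sees exactly the touching neighbours),
`shellFinset_subset` + cardinality (`12 = 12`, `BarlowCoordination.ncard_touching_eq_twelve`), and
**`goodShell_hcpStacking`**: every point of `hcpStacking a (a√⅔)`, `a ∈ [9/10, 1]`, has a `(1/100)`-good HCP
shell in the sense of the crux — an EXACT rotated scaled anticuboctahedron (`M` at `A`-sites, `−M` at
`B`-sites; the tolerance is not used). All `[folklore]`.
-/

noncomputable section

namespace Summit.AtomisticToContinuum.Crystallization.Theorems.LayeredLawsSelectHcp.Negative.HcpShells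

open MeasureTheory Set
open Literature.MathematicalPhysics.StatisticalMechanics Literature.Geometry.DiscreteGeometry
open Summit.AtomisticToContinuum.Crystallization.Theses.PalmUnimodularRigidity (LayeredLawsSelectHcp)
open Summit.AtomisticToContinuum.Crystallization.Theorems.ChargedEnergyGapNegative
  (eStar eStar_le bddBelow_energyPerParticle_lennardJones)
open Summit.AtomisticToContinuum.Crystallization.Theorems.LayeredLawsSelectHcp.Negative.DiracLaws
open Summit.AtomisticToContinuum.Crystallization.Theorems.LayeredLawsSelectHcp.Negative.IntegerForms
open Summit.AtomisticToContinuum.Crystallization.Theorems.LayeredLawsSelectHcp.Negative.IdealStackings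
open Summit.AtomisticToContinuum.Crystallization.Theorems.LayeredLawsSelectHcp.Negative.HexCubic

/-- Euclidean `3`-space. [folklore] -/
local notation "E3" => EuclideanSpace ℝ (Fin 3)

/-! ## hcp has EXACT anticuboctahedral shells: the intended model satisfies H4 (and H1, H2) -/

section HcpShells

/-- The table `q ↦ (i, j, Λ, K)`: the image under `M` of the anticuboctahedron point `q/√18`,
`q ∈ hcpInt`, is `i u + j v + Λ w + K n` — the twelve neighbour offsets of an `A`-site of hcp
(hexagon; `{w, w−u, w−v} ± n`). [folklore] -/
def hcpOffsetIdx : Finset (ℤ × ℤ × ℤ × ℤ) :=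
  {(1, 0, 0, 0), (-1, 0, 0, 0), (1, -1, 0, 0), (-1, 1, 0, 0), (0, -1, 0, 0), (0, 1, 0, 0),
   (0, -1, 1, 1), (0, 0, 1, 1), (-1, 0, 1, 1), (0, -1, 1, -1), (0, 0, 1, -1), (-1, 0, 1, -1)}

/-- **The integer content of "`M` maps the HCP pattern onto the hcp shell"**: every `q ∈ hcpInt`
satisfies the three relations of the master formula with some `(i, j, Λ, K)` of the table
(checked by `decide`). [folklore] -/
theorem hcpInt_rel : ∀ q ∈ hcpInt, ∃ t ∈ hcpOffsetIdx,
    q 0 - q 1 = 3 * (2 * t.1 + t.2.1 + t.2.2.1) ∧ -q 0 - q 1 + 2 * q 2 = 3 * (3 * t.2.1 + t.2.2.1) ∧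
      q 0 + q 1 + q 2 = 6 * t.2.2.2 := by
  decide

/-- In the table, the letter shift `Λ` is `0` in the layer and `1` across (A-site geometry) and
`|K| ≤ 1`. [folklore] -/
theorem hcpOffsetIdx_shape : ∀ t ∈ hcpOffsetIdx,
    (t.2.2.2 = 0 ∧ t.2.2.1 = 0) ∨ (t.2.2.2 = 1 ∧ t.2.2.1 = 1) ∨ (t.2.2.2 = -1 ∧ t.2.2.1 = 1) := by
  decide

/-- `√18 = 3√2`, so `(√18)⁻¹ · √2 = 1/3`. [folklore] -/
theorem inv_sqrt_eighteen_mul_sqrt_two : (Real.sqrt 18)⁻¹ * Real.sqrt 2 = 1 / 3 := by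
  have h18 : Real.sqrt 18 = 3 * Real.sqrt 2 := by
    rw [show (18 : ℝ) = 3 ^ 2 * 2 by norm_num, Real.sqrt_mul (by norm_num), Real.sqrt_sq (by norm_num)]
  have h2 : Real.sqrt 2 ≠ 0 := by positivity
  rw [h18, mul_inv, mul_assoc, inv_mul_cancel₀ h2, mul_one]
  norm_num

/-- **`M` maps each point of the HCP kissing pattern to a tabulated hcp `A`-site offset.** [folklore] -/
theorem hexIso_hcpPattern (q : E3) (hq : q ∈ hcpKissingPattern) :
    ∃ t ∈ hcpOffsetIdx, hexIso q =
      (t.1 : ℝ) • triangularVec₁ 1 + (t.2.1 : ℝ) • triangularVec₂ 1 + (t.2.2.1 : ℝ) • barlowOffset 1 +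
        (t.2.2.2 : ℝ) • layerNormal (Real.sqrt (2 / 3)) := by
  obtain ⟨p, hp, rfl⟩ := Finset.mem_image.1 hq
  obtain ⟨t, ht, r1, r2, r3⟩ := hcpInt_rel p hp
  refine ⟨t, ht, ?_⟩
  have hc : (Real.sqrt ((18 : ℕ) : ℝ))⁻¹ * Real.sqrt 2 = 1 / 3 := by
    rw [Nat.cast_ofNat]; exact inv_sqrt_eighteen_mul_sqrt_two
  have r1' : ((p 0 : ℤ) : ℝ) - p 1 = 3 * (2 * t.1 + t.2.1 + t.2.2.1) := by exact_mod_cast r1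
  have r2' : -((p 0 : ℤ) : ℝ) - p 1 + 2 * p 2 = 3 * (3 * t.2.1 + t.2.2.1) := by exact_mod_cast r2
  have r3' : ((p 0 : ℤ) : ℝ) + p 1 + p 2 = 6 * t.2.2.2 := by exact_mod_cast r3
  refine hexIso_smul_intVec _ p _ _ _ _ ?_ ?_ ?_
  · rw [r1', ← mul_assoc, hc]; ring
  · rw [r2', ← mul_assoc, hc]; ring
  · rw [r3', ← mul_assoc, hc]; ring

variable {a : ℝ}

/-- The difference of two points of a Barlow stacking, in layer coordinates (ideal ratio). [folklore] -/
theorem barlowPos_sub_barlowPos (a η : ℝ) (s : ℤ → ℤ) (k i j k' i' j' : ℤ) :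
    barlowPos a (a * η) s k' i' j' - barlowPos a (a * η) s k i j =
      a • (((i' - i : ℤ) : ℝ) • triangularVec₁ 1 + ((j' - j : ℤ) : ℝ) • triangularVec₂ 1 +
        ((haggLabel s k' - haggLabel s k : ℤ) : ℝ) • barlowOffset 1 +
          ((k' - k : ℤ) : ℝ) • layerNormal η) := by
  ext l
  fin_cases l <;> simp [triangularVec₁, triangularVec₂, barlowOffset, layerNormal] <;> ring

/-- Layer labels of hcp around an even (`A`) layer: `L(k) = 0`, `L(k ± 1) = 1`. [folklore] -/
theorem haggLabel_alt_of_even {k : ℤ} (hk : Even k) :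
    haggLabel alternatingHagg k = 0 ∧ haggLabel alternatingHagg (k + 1) = 1 ∧
      haggLabel alternatingHagg (k - 1) = 1 := by
  have h1 : ¬ Even (k + 1) := fun h => by
    have := Int.even_sub.2 (iff_of_true h hk); simp at this
  have h2 : ¬ Even (k - 1) := fun h => by
    have := Int.even_sub.2 (iff_of_true hk h); simp at this
  simp [haggLabel_alternating, hk, h1, h2]

/-- Layer labels of hcp around an odd (`B`) layer: `L(k) = 1`, `L(k ± 1) = 0`. [folklore] -/
theorem haggLabel_alt_of_odd {k : ℤ} (hk : ¬ Even k) :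
    haggLabel alternatingHagg k = 1 ∧ haggLabel alternatingHagg (k + 1) = 0 ∧
      haggLabel alternatingHagg (k - 1) = 0 := by
  have h1 : Even (k + 1) := by
    rcases Int.even_or_odd k with h | h
    · exact absurd h hk
    · exact h.add_one
  have h2 : Even (k - 1) := by
    rcases Int.even_or_odd k with h | h
    · exact absurd h hk
    · exact h.sub_odd odd_one
  simp [haggLabel_alternating, hk, h1, h2]

/-- `(a√(2/3))² = ⅔a²`. [folklore] -/
theorem idealRatio_sq (a : ℝ) : (a * Real.sqrt (2 / 3)) ^ 2 = 2 / 3 * a ^ 2 := by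
  rw [mul_pow, Real.sq_sqrt (by norm_num)]; ring

/-- **The shell window of the crux sees exactly the touching neighbours** in an ideal hcp (indeed any
ideal Barlow stacking): `y ≠ p ∧ dist y p ≤ 5a/4 ↔ dist p y = a`. [folklore] -/
theorem shellWindow_eq_touching (ha : 0 < a) {p : E3} (hp : p ∈ barlowStacking a (a * Real.sqrt (2 / 3)) alternatingHagg) :
    {y : E3 | y ∈ barlowStacking a (a * Real.sqrt (2 / 3)) alternatingHagg ∧ y ≠ p ∧ dist y p ≤ 5 / 4 * a} = {y : E3 | y ∈ barlowStacking a (a * Real.sqrt (2 / 3)) alternatingHagg ∧ dist p y = a} := by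
  obtain ⟨k, i, j, rfl⟩ := hp
  ext y
  simp only [Set.mem_setOf_eq]
  constructor
  · rintro ⟨hy, hne, hle⟩
    obtain ⟨k', i', j', rfl⟩ := hy
    refine ⟨barlowPos_mem _ _ _, ?_⟩
    have hne' : (k, i, j) ≠ (k', i', j') := by
      rintro heq
      simp only [Prod.mk.injEq] at heq
      obtain ⟨rfl, rfl, rfl⟩ := heq
      exact hne rfl
    rw [dist_comm] at hle
    exact dist_eq_of_le_of_ideal isHaggSeq_alternating ha (idealRatio_sq a) hne' hle
  · rintro ⟨hy, hd⟩
    refine ⟨hy, fun h => ?_, ?_⟩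
    · rw [h, dist_self] at hd; linarith
    · rw [dist_comm, hd]; linarith

/-- The isometry at a site of parity `k`: `M` at `A`-sites (even `k`), `−M` at `B`-sites. [folklore] -/
def siteIso (k : ℤ) : E3 →ₗᵢ[ℝ] E3 :=
  if Even k then hexIso else (LinearIsometryEquiv.neg ℝ (E := E3)).toLinearIsometry.comp hexIso

/-- The candidate shell finset at a site of layer `k`: the rotated scaled HCP pattern. [folklore] -/
def shellFinset (a : ℝ) (k : ℤ) : Finset E3 :=
  ((hcpKissingPattern.image fun v : E3 => a • v).image (siteIso k))

/-- The candidate shell has twelve points (`a ≠ 0`). [folklore] -/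
theorem card_shellFinset (ha : a ≠ 0) (k : ℤ) : (shellFinset a k).card = 12 := by
  unfold shellFinset
  rw [Finset.card_image_of_injective _ (siteIso k).injective,
    Finset.card_image_of_injective _ (smul_right_injective E3 ha), card_hcpKissingPattern]

/-- **Each point of the candidate shell IS a touching neighbour offset** of the site
`p = barlowPos a (a√⅔) alternatingHagg k i j`. [folklore] -/
theorem shellFinset_subset (ha : 0 < a) (k i j : ℤ) :
    (↑(shellFinset a k) : Set E3) ⊆ (fun y : E3 => y - barlowPos a (a * Real.sqrt (2 / 3)) alternatingHagg k i j) ''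
      {y : E3 | y ∈ barlowStacking a (a * Real.sqrt (2 / 3)) alternatingHagg ∧ dist (barlowPos a (a * Real.sqrt (2 / 3)) alternatingHagg k i j) y = a} := by
  intro z hz
  rw [Finset.mem_coe, shellFinset, Finset.mem_image] at hz
  obtain ⟨_, hq', rfl⟩ := hz
  obtain ⟨q, hq, rfl⟩ := Finset.mem_image.1 hq'
  obtain ⟨t, ht, hM⟩ := hexIso_hcpPattern q hq
  set p := barlowPos a (a * Real.sqrt (2 / 3)) alternatingHagg k i j with hpdef
  have hnorm : ∀ y : E3, y - p = (siteIso k) (a • q) →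
      y ∈ barlowStacking a (a * Real.sqrt (2 / 3)) alternatingHagg →
      (siteIso k) (a • q) ∈ (fun y : E3 => y - p) ''
        {y : E3 | y ∈ barlowStacking a (a * Real.sqrt (2 / 3)) alternatingHagg ∧ dist p y = a} := by
    intro y hy hyS
    refine ⟨y, ⟨hyS, ?_⟩, hy⟩
    rw [dist_comm, dist_eq_norm, hy, LinearIsometry.norm_map, norm_smul,
      norm_eq_one_of_mem_hcpKissingPattern hq, mul_one, Real.norm_of_nonneg ha.le]
  by_cases hk : Even k
  · -- A-site: neighbour at (k + K, i + i_t, j + j_t)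
    obtain ⟨hL0, hL1, hLm1⟩ := haggLabel_alt_of_even hk
    have hsite : siteIso k = hexIso := by simp [siteIso, hk]
    refine hnorm (barlowPos a (a * Real.sqrt (2 / 3)) alternatingHagg (k + t.2.2.2) (i + t.1) (j + t.2.1)) ?_
      (barlowPos_mem _ _ _)
    rw [hsite, LinearIsometry.map_smul, hM, hpdef, barlowPos_sub_barlowPos]
    congr 1
    have hΛ : ((haggLabel alternatingHagg (k + t.2.2.2) - haggLabel alternatingHagg k : ℤ) : ℝ) = t.2.2.1 := by
      rcases hcpOffsetIdx_shape t ht with ⟨hK, hΛ⟩ | ⟨hK, hΛ⟩ | ⟨hK, hΛ⟩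
      · rw [hK, hΛ, add_zero, sub_self]
      · rw [hK, hΛ, hL1, hL0]; simp
      · rw [hK, hΛ, ← sub_eq_add_neg, hLm1, hL0]; simp
    rw [hΛ]
    push_cast
    module
  · -- B-site: neighbour at (k - K, i - i_t, j - j_t), isometry -M
    obtain ⟨hL0, hL1, hLm1⟩ := haggLabel_alt_of_odd hk
    have hsite : ∀ x : E3, siteIso k x = -hexIso x := fun x => by simp [siteIso, hk]
    refine hnorm (barlowPos a (a * Real.sqrt (2 / 3)) alternatingHagg (k - t.2.2.2) (i - t.1) (j - t.2.1)) ?_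
      (barlowPos_mem _ _ _)
    rw [hsite, LinearIsometry.map_smul, hM, hpdef, barlowPos_sub_barlowPos, ← smul_neg]
    congr 1
    have hΛ : ((haggLabel alternatingHagg (k - t.2.2.2) - haggLabel alternatingHagg k : ℤ) : ℝ) = -t.2.2.1 := by
      rcases hcpOffsetIdx_shape t ht with ⟨hK, hΛ⟩ | ⟨hK, hΛ⟩ | ⟨hK, hΛ⟩
      · rw [hK, hΛ, sub_zero, sub_self]; simp
      · rw [hK, hΛ, hLm1, hL0]; simp
      · rw [hK, hΛ, sub_neg_eq_add, hL1, hL0]; simp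
    rw [hΛ]
    push_cast
    module

/-- **Every point of the ideal hcp of spacing `a ∈ [9/10, 1]` has a `(1/100)`-good HCP shell** — an
EXACT rotated, scaled anticuboctahedron (isometry `M` at `A`-sites, `−M` at `B`-sites; tolerance
unused). [folklore] -/
theorem goodShell_hcp_ideal (h9 : 9 / 10 ≤ a) (h1 : a ≤ 1) {p : E3}
    (hp : p ∈ barlowStacking a (a * Real.sqrt (2 / 3)) alternatingHagg) :
    GoodShell (barlowStacking a (a * Real.sqrt (2 / 3)) alternatingHagg) p := by
  have ha : 0 < a := by linarith
  obtain ⟨k, i, j, rfl⟩ := hp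
  refine ⟨a, h9, h1, shellFinset a k, ?_, Or.inr ⟨siteIso k, EtaMatched.refl (by positivity) _⟩⟩
  rw [shellWindow_eq_touching ha (barlowPos_mem k i j)]
  refine Set.eq_of_subset_of_ncard_le (shellFinset_subset ha k i j) ?_ ?_
  · rw [Set.ncard_image_of_injective _ sub_left_injective,
      ncard_touching_eq_twelve isHaggSeq_alternating ha (idealRatio_sq a) (barlowPos_mem k i j),
      Set.ncard_coe_finset, card_shellFinset ha.ne']
  · exact (Set.finite_of_ncard_pos (by
      rw [ncard_touching_eq_twelve isHaggSeq_alternating ha (idealRatio_sq a) (barlowPos_mem k i j)]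
      norm_num)).image _

/-- The same for `hcpStacking a (a√(2/3))` by name. [folklore] -/
theorem goodShell_hcpStacking (h9 : 9 / 10 ≤ a) (h1 : a ≤ 1) {p : E3}
    (hp : p ∈ hcpStacking a (a * Real.sqrt (2 / 3))) : GoodShell (hcpStacking a (a * Real.sqrt (2 / 3))) p :=
  goodShell_hcp_ideal h9 h1 hp

end HcpShells

end Summit.AtomisticToContinuum.Crystallization.Theorems.LayeredLawsSelectHcp.Negative.HcpShells

end
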